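import Literature.AlgebraicGeometry.Smoothening.ForestStepData
import HarnessLib

/-!
# Smoothenings of a chart relative to its points: paths, the structure, combinators (BLR 3.4)

Topic: `Literature/AlgebraicGeometry/Smoothening` (Bosch–Lütkebohmert–Raynaud, *Néron Models*,
§3.4 Thm. 2, affine-forest form). The smoothening process replaces a chart
`X = Spec R[T₁, …, T_N]/I` by finitely many charts reached from `X` by a **path** of elementary
steps (`ForestPath`): passing to the open chart `X ∩ D(f)` presented in `R[T, U]` (`OpenChart`),
or to the dilatation of `X ∩ D(h)` in the centre `(ϖ, g, hU - 1)` presented in `R[T, U, Z]`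
(`DilatationChart`, `ForestStepData.toDilChart`); a path has a structure map `ForestPath.map` and
paths compose (`ForestPath.trans`, `ForestPath.map_trans`). A **smoothening of the points of `X`
served by `V(𝔷)`** (`NeronSmoothening`, a structure carrying the data) is a finite family of
paths from `X` such that every point `a : R[T]/I → S` of `X` with values in a discrete valuation
`R`-algebra `S` in which `ϖ` is a uniformizer and reducing into `V(𝔷)`
(`∀ z ∈ 𝔷, a z̄ ∈ 𝔪_S`) lifts along the structure map of one of them to a point `a'` at which
Néron's measure vanishes, `δ(a') = 0`. Combinators used by the induction (`Forest`): the trivial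
smoothening (`NeronSmoothening.ofForallEqZero`) and the assembly of smoothenings of finitely
many target charts along routes covering the served points (`NeronSmoothening.ofRoutes`).
Recording paths (rather than bare algebra maps) keeps the geometry of the charts available:
every step is an isomorphism or an open immersion on generic fibres. [folklore]; no named facts
(D-0026).

## References

* S. Bosch, W. Lütkebohmert, M. Raynaud, *Néron Models*, Springer 1990, §3.4 Thm. 2.
  [BLRNeronModels1990] (Not held; number only.)
-/

noncomputable section

open MvPolynomial IsLocalRing

namespace Literature.AlgebraicGeometry.Smoothening

universe u

/-! ### Paths of the affine forest -/

/-- **A path of the affine forest** from the chart `R[T₁, …, T_N]/I` to the chart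
`R[T₁, …, T_{N'}]/I'`: a finite sequence of steps, each either the open chart `X ∩ D(f)` in
`R[T, U]` (`chartIdeal`) or the dilatation of `X ∩ D(h)` in `(ϖ, g, hU - 1)` in `R[T, U, Z]`
(`dilIdeal`). [folklore] -/
inductive ForestPath (R : Type u) [CommRing R] (ϖ : R) {N : ℕ} (I : Ideal (MvPolynomial (Fin N) R)) :
    ∀ {N' : ℕ}, Ideal (MvPolynomial (Fin N') R) → Type u
  /-- the empty path -/
  | refl : ForestPath R ϖ I I
  /-- a path followed by the open chart `D(f)` -/
  | openChart {N' : ℕ} {I' : Ideal (MvPolynomial (Fin N') R)} (p : ForestPath R ϖ I I')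
      (f : MvPolynomial (Fin N') R) : ForestPath R ϖ I (chartIdeal I' f)
  /-- a path followed by the dilatation of `D(h)` in `(ϖ, g, hU - 1)` -/
  | dilChart {N' r : ℕ} {I' : Ideal (MvPolynomial (Fin N') R)} (p : ForestPath R ϖ I I')
      (g : Fin r → MvPolynomial (Fin N') R) (h : MvPolynomial (Fin N') R) :
      ForestPath R ϖ I (dilIdeal ϖ (chartIdeal I' h) (chartGens g h))

namespace ForestPath

variable {R : Type u} [CommRing R] {ϖ : R} {N : ℕ} {I : Ideal (MvPolynomial (Fin N) R)}

/-- **The structure map of a path** `R[T]/I → R[T']/I'`. [folklore] -/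
def map : ∀ {N' : ℕ} {I' : Ideal (MvPolynomial (Fin N') R)}, ForestPath R ϖ I I' →
    ((MvPolynomial (Fin N) R ⧸ I) →ₐ[R] (MvPolynomial (Fin N') R ⧸ I'))
  | _, _, refl => AlgHom.id R _
  | _, _, openChart p f =>
      (IsScalarTower.toAlgHom R _ (MvPolynomial (Fin _) R ⧸ chartIdeal _ f)).comp p.map
  | _, _, dilChart p g h => (toDilChart ϖ _ g h).comp p.map

/-- The structure map of the empty path is the identity (unfolding). [folklore] -/
@[simp]
theorem map_refl : (refl : ForestPath R ϖ I I).map = AlgHom.id R _ := rfl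

/-- The structure map of a path ending in an open chart (unfolding). [folklore] -/
@[simp]
theorem map_openChart {N' : ℕ} {I' : Ideal (MvPolynomial (Fin N') R)} (p : ForestPath R ϖ I I')
    (f : MvPolynomial (Fin N') R) :
    (p.openChart f).map = (IsScalarTower.toAlgHom R _ _).comp p.map := rfl

/-- The structure map of a path ending in a dilatation chart (unfolding). [folklore] -/
@[simp]
theorem map_dilChart {N' r : ℕ} {I' : Ideal (MvPolynomial (Fin N') R)} (p : ForestPath R ϖ I I')
    (g : Fin r → MvPolynomial (Fin N') R) (h : MvPolynomial (Fin N') R) :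
    (p.dilChart g h).map = (toDilChart ϖ I' g h).comp p.map := rfl

/-- **Composition of paths.** [folklore] -/
def trans {N' : ℕ} {I' : Ideal (MvPolynomial (Fin N') R)} (p : ForestPath R ϖ I I') :
    ∀ {N'' : ℕ} {I'' : Ideal (MvPolynomial (Fin N'') R)}, ForestPath R ϖ I' I'' → ForestPath R ϖ I I''
  | _, _, refl => p
  | _, _, openChart q f => (p.trans q).openChart f
  | _, _, dilChart q g h => (p.trans q).dilChart g h

/-- The structure map of a composite path is the composite of the structure maps. [folklore] -/
theorem map_trans {N' : ℕ} {I' : Ideal (MvPolynomial (Fin N') R)} (p : ForestPath R ϖ I I') :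
    ∀ {N'' : ℕ} {I'' : Ideal (MvPolynomial (Fin N'') R)} (q : ForestPath R ϖ I' I''),
      (p.trans q).map = q.map.comp p.map
  | _, _, refl => by rw [map_refl, AlgHom.id_comp]; rfl
  | _, _, openChart q f => by
      change ((IsScalarTower.toAlgHom R _ _).comp (p.trans q).map) = _
      rw [map_trans p q, map_openChart, AlgHom.comp_assoc]
  | _, _, dilChart q g h => by
      change ((toDilChart ϖ _ g h).comp (p.trans q).map) = _
      rw [map_trans p q, map_dilChart, AlgHom.comp_assoc]

/-- The structure map of a composite path, pointwise. [folklore] -/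
theorem map_trans_apply {N' : ℕ} {I' : Ideal (MvPolynomial (Fin N') R)} (p : ForestPath R ϖ I I')
    {N'' : ℕ} {I'' : Ideal (MvPolynomial (Fin N'') R)} (q : ForestPath R ϖ I' I'')
    (x : MvPolynomial (Fin N) R ⧸ I) : (p.trans q).map x = q.map (p.map x) := by
  rw [map_trans]; rfl

end ForestPath

/-! ### Smoothenings -/

/-- **A smoothening of the points of `Spec R[T]/I` served by `V(𝔷)`** (BLR 3.4 Thm. 2, affine
forest form): finitely many paths of the affine forest from the chart such that every point
reducing into `V(𝔷)`, with values in a discrete valuation `R`-algebra in which `ϖ` is a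
uniformizer, lifts along the structure map of one of them to a point with `δ = 0`. [folklore] -/
structure NeronSmoothening (R : Type u) [CommRing R] (ϖ : R) {N : ℕ}
    (I 𝔷 : Ideal (MvPolynomial (Fin N) R)) : Type (u + 1) where
  /-- the index set of the charts -/
  ι : Type u
  /-- there are finitely many charts -/
  [fintype : Fintype ι]
  /-- the numbers of variables of the charts -/
  N' : ι → ℕ
  /-- the ideals of the charts -/
  I' : ∀ i, Ideal (MvPolynomial (Fin (N' i)) R)
  /-- the paths to the charts -/
  path : ∀ i, ForestPath R ϖ I (I' i)
  /-- every served point lifts to a point of some chart at which `δ` vanishes -/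
  lift : ∀ (S : Type u) [CommRing S] [IsDomain S] [IsDiscreteValuationRing S] [Algebra R S],
    Irreducible (algebraMap R S ϖ) →
      ∀ a : (MvPolynomial (Fin N) R ⧸ I) →ₐ[R] S,
        (∀ z ∈ 𝔷, a (Ideal.Quotient.mk I z) ∈ maximalIdeal S) →
          ∃ (i : ι) (a' : (MvPolynomial (Fin (N' i)) R ⧸ I' i) →ₐ[R] S),
            (∀ x, a' ((path i).map x) = a x) ∧ neronDefectOfHom R S a' = 0

attribute [instance] NeronSmoothening.fintype

namespace NeronSmoothening

variable {R : Type u} [CommRing R] {ϖ : R} {N : ℕ} {I 𝔷 : Ideal (MvPolynomial (Fin N) R)}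

/-- **The trivial smoothening**: if every served point already has `δ = 0`, the empty path will
do. [folklore] -/
def ofForallEqZero
    (h : ∀ (S : Type u) [CommRing S] [IsDomain S] [IsDiscreteValuationRing S] [Algebra R S],
      Irreducible (algebraMap R S ϖ) → ∀ a : (MvPolynomial (Fin N) R ⧸ I) →ₐ[R] S,
        (∀ z ∈ 𝔷, a (Ideal.Quotient.mk I z) ∈ maximalIdeal S) → neronDefectOfHom R S a = 0) :
    NeronSmoothening R ϖ I 𝔷 where
  ι := PUnit
  N' _ := N
  I' _ := I
  path _ := ForestPath.refl
  lift S _ _ _ _ hπ a ha := ⟨PUnit.unit, a, fun _ => rfl, h S hπ a ha⟩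

/-- **A route**: a path `ψ` towards a chart equipped with a smoothening of its `V(𝔷₁)`-served
points. [folklore] -/
structure Route (R : Type u) [CommRing R] (ϖ : R) {N : ℕ} (I : Ideal (MvPolynomial (Fin N) R)) :
    Type (u + 1) where
  /-- the number of variables of the target chart -/
  N₁ : ℕ
  /-- the ideal of the target chart -/
  I₁ : Ideal (MvPolynomial (Fin N₁) R)
  /-- the served region of the target chart -/
  𝔷₁ : Ideal (MvPolynomial (Fin N₁) R)
  /-- the path to the target chart -/
  ψ : ForestPath R ϖ I I₁
  /-- the smoothening of the target chart -/
  smooth : NeronSmoothening R ϖ I₁ 𝔷₁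

/-- **Assembling smoothenings along routes**: if finitely many routes cover the served points
— every served point lifts along some route to a served point of its target — then the chart
has a smoothening (whose paths are the composites). [folklore] -/
def ofRoutes {κ : Type u} [Fintype κ] (ρ : κ → Route R ϖ I)
    (hcover : ∀ (S : Type u) [CommRing S] [IsDomain S] [IsDiscreteValuationRing S] [Algebra R S],
      Irreducible (algebraMap R S ϖ) → ∀ a : (MvPolynomial (Fin N) R ⧸ I) →ₐ[R] S,
        (∀ z ∈ 𝔷, a (Ideal.Quotient.mk I z) ∈ maximalIdeal S) →
          ∃ (k : κ) (a₁ : (MvPolynomial (Fin (ρ k).N₁) R ⧸ (ρ k).I₁) →ₐ[R] S),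
            (∀ x, a₁ ((ρ k).ψ.map x) = a x) ∧
              ∀ z ∈ (ρ k).𝔷₁, a₁ (Ideal.Quotient.mk (ρ k).I₁ z) ∈ maximalIdeal S) :
    NeronSmoothening R ϖ I 𝔷 where
  ι := Σ k, (ρ k).smooth.ι
  N' p := (ρ p.1).smooth.N' p.2
  I' p := (ρ p.1).smooth.I' p.2
  path p := (ρ p.1).ψ.trans ((ρ p.1).smooth.path p.2)
  lift S _ _ _ _ hπ a ha := by
    obtain ⟨k, a₁, ha₁, hserved⟩ := hcover S hπ a ha
    obtain ⟨i, a', ha', hδ⟩ := (ρ k).smooth.lift S hπ a₁ hserved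
    exact ⟨⟨k, i⟩, a', fun x => by rw [ForestPath.map_trans_apply, ha', ha₁], hδ⟩

end NeronSmoothening

end Literature.AlgebraicGeometry.Smoothening

end
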